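import Summits.ValiantsHypothesis.ValiantsHypothesis.Theses.BorderApolarity
import Summits.ValiantsHypothesis.ValiantsHypothesis.Theorems.ToricFixedPoints.Negative.WithoutOrbitFalse
import Literature.Computability.AlgebraicComplexity.ApolarityAction

/-!
# `ToricFixedPoints` — negative lemma: the lower Kuratowski clause (Li) is load-bearing

Crux `Summit.ValiantsHypothesis.ValiantsHypothesis.Theses.BorderApolarity.ToricFixedPoints`
(stmt-ValiantsHypothesis-5779).  `ToricFixedPointsWithoutLowerLimit` is the crux with the hypothesis
clause (Li) `∀ k ≤ m, ∀ D ∈ J k, ∃ Ds, (∀ t, Ds t ∈ Ann_k(P t)) ∧ Ds → D` deleted (text otherwise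
verbatim); `toricFixedPoints_false_without_lowerLimit` proves it is false: witness `n = m = 3`,
`P_t = det_3` (in the orbit), `J_k = {all degree-k forms}` — the remaining hypotheses hold ((Ls):
coefficientwise limits of degree-`k` forms are degree-`k` forms; `H₀`-stability: linear substitutions
preserve degree), while the conclusion's own clause (Li') fails in degree `0` at `D = C 1`, because the
degree-`0` annihilator of a non-zero polynomial is `0` and translates of `det_3` along the toric curve
are non-zero.  Moral for provers: (Li) is the ONLY hypothesis bounding `J_k` from above (by the Hilbert
function of `det_m^⊥`).  Refuter cdisprove unit, cycle 2 (`Cruxes/ToricFixedPoints/Disproof.lean` §2).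
[folklore]
-/

namespace Summit.ValiantsHypothesis.Cruxes.ToricFixedPoints.Negative


open Literature.Computability.AlgebraicComplexity
open scoped BigOperators Matrix
open Filter MvPolynomial

/-- The crux with the clause (Li) `∀ k ≤ m, ∀ D ∈ J k, ∃ Ds → …` DELETED from the hypotheses (text
otherwise verbatim). -/
def ToricFixedPointsWithoutLowerLimit : Prop :=
  ∀ (n m : ℕ) [NeZero m], 3 ≤ n → n ≤ m → let act := fun (D f : MvPolynomial (Fin m × Fin m) ℂ) => ∑ e ∈ D.support, ∑ d ∈ f.support, MvPolynomial.monomial (d - e) (MvPolynomial.coeff e D * MvPolynomial.coeff d f * ∏ i ∈ e.support, (Nat.descFactorial (d i) (e i) : ℂ)); let rk := fun (p : Fin m × Fin m) => (if (m - n ≤ (p.1 : ℕ) ∧ m - n ≤ (p.2 : ℕ)) ∨ p = (0, 0) then 0 else m * m) + ((p.1 : ℕ) * m + (p.2 : ℕ)); ∀ (P : ℕ → MvPolynomial (Fin m × Fin m) ℂ) (J : ℕ → Set (MvPolynomial (Fin m × Fin m) ℂ)), (∀ t : ℕ, P t ∈ Literature.Computability.AlgebraicComplexity.glOrbit (Fin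 m × Fin m) ℂ (Literature.Computability.AlgebraicComplexity.detPoly (Fin m) ℂ)) → (∀ k ≤ m, ∀ (D : MvPolynomial (Fin m × Fin m) ℂ) (φ : ℕ → ℕ) (Ds : ℕ → MvPolynomial (Fin m × Fin m) ℂ), StrictMono φ → (∀ t, (Ds t).IsHomogeneous k ∧ act (Ds t) (P (φ t)) = 0) → Filter.Tendsto (fun t => Literature.Computability.AlgebraicComplexity.coeffVec (Ds t)) Filter.atTop (nhds (Literature.Computability.AlgebraicComplexity.coeffVec D)) → D ∈ J k) → (∀ A : Matrix.GeneralLinearGroup (Fin m × Fin m) ℂ, let M : Matrix (Fin m × Fin m) (Fin m × Fin m) ℂ := A; (∀ i j : Fin m × Fin m, M j i ≠ 0 → rk j ≤ rk i) → (∀ i j : Fin m × Fin m, ((m - n ≤ (i.1 : ℕ) ∧ m - n ≤ (i.2 : ℕ)) ∨ i = (0, 0)) → j ≠ i → M j i = 0) → (∀ i k j l : Fin m, m - n ≤ (i : ℕ) → m - n ≤ (k : ℕ) → m - n ≤ (j : ℕ) → m - n ≤ (l : ℕ) → M (i, j) (i, j) * M (k, l) (k, l) = M (i, l) (i, l) *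 M (k, j) (k, j)) → M (0, 0) (0, 0) ^ (m - n) * ∏ i ∈ Finset.univ.filter (fun i : Fin m => m - n ≤ (i : ℕ)), M (i, i) (i, i) = 1 → ∀ k ≤ m, ∀ D ∈ J k, Literature.Computability.AlgebraicComplexity.linSubst (Fin m × Fin m) ℂ Mᵀ D ∈ J k) → ∃ (u g : Matrix.GeneralLinearGroup (Fin m × Fin m) ℂ) (w : Fin m × Fin m → ℤ), let Q : ℕ → MvPolynomial (Fin m × Fin m) ℂ := fun t => Literature.Computability.AlgebraicComplexity.linSubst (Fin m × Fin m) ℂ (u : Matrix (Fin m × Fin m) (Fin m × Fin m) ℂ) (Literature.Computability.AlgebraicComplexity.linSubst (Fin m × Fin m) ℂ (Matrix.diagonal fun i : Fin m × Fin m => ((t : ℂ) + 2) ^ (w i)) (Literature.Computability.AlgebraicComplexity.linSubst (Fin m × Fin m) ℂ (g : Matrix (Fin m × Fin m) (Fin m × Fin m) ℂ) (Literature.Computability.AlgebraicComplexity.detPoly (Fin m) ℂ))); (∀ k ≤ m, ∀ D ∈ J k, ∃ Ds : ℕ → MvPolynomial (Fin m × Fin m) ℂ, (∀ t, (Ds t).IsHomogeneous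 k ∧ act (Ds t) (Q t) = 0) ∧ Filter.Tendsto (fun t => Literature.Computability.AlgebraicComplexity.coeffVec (Ds t)) Filter.atTop (nhds (Literature.Computability.AlgebraicComplexity.coeffVec D))) ∧ (∀ k ≤ m, ∀ (D : MvPolynomial (Fin m × Fin m) ℂ) (φ : ℕ → ℕ) (Ds : ℕ → MvPolynomial (Fin m × Fin m) ℂ), StrictMono φ → (∀ t, (Ds t).IsHomogeneous k ∧ act (Ds t) (Q (φ t)) = 0) → Filter.Tendsto (fun t => Literature.Computability.AlgebraicComplexity.coeffVec (Ds t)) Filter.atTop (nhds (Literature.Computability.AlgebraicComplexity.coeffVec D)) → D ∈ J k)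

/-- Translates of `det_m` along the crux's toric curve are non-zero. [folklore] -/
theorem toricCurve_ne_zero {m : ℕ} (u g : Matrix.GeneralLinearGroup (Fin m × Fin m) ℂ)
    (w : Fin m × Fin m → ℤ) (t : ℕ) :
    linSubst (Fin m × Fin m) ℂ (u : Matrix (Fin m × Fin m) (Fin m × Fin m) ℂ)
      (linSubst (Fin m × Fin m) ℂ (Matrix.diagonal fun i : Fin m × Fin m => ((t : ℂ) + 2) ^ (w i))
        (linSubst (Fin m × Fin m) ℂ (g : Matrix (Fin m × Fin m) (Fin m × Fin m) ℂ) (detPoly (Fin m) ℂ))) ≠ 0 := by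
  have hdet : detPoly (Fin m) ℂ ≠ 0 := Matrix.det_mvPolynomialX_ne_zero (Fin m) ℂ
  have hu := linSubst_injective_of_mul_eq_one (u : Matrix (Fin m × Fin m) (Fin m × Fin m) ℂ)
    ((u⁻¹ : Matrix.GeneralLinearGroup (Fin m × Fin m) ℂ) : Matrix (Fin m × Fin m) (Fin m × Fin m) ℂ) (by simp)
  have hg := linSubst_injective_of_mul_eq_one (g : Matrix (Fin m × Fin m) (Fin m × Fin m) ℂ)
    ((g⁻¹ : Matrix.GeneralLinearGroup (Fin m × Fin m) ℂ) : Matrix (Fin m × Fin m) (Fin m × Fin m) ℂ) (by simp)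
  have ht2 : ((t : ℂ) + 2) ≠ 0 := by
    have : (0 : ℝ) < (t : ℝ) + 2 := by positivity
    exact_mod_cast this.ne'
  have hd := linSubst_injective_of_mul_eq_one
    (Matrix.diagonal fun i : Fin m × Fin m => ((t : ℂ) + 2) ^ (w i))
    (Matrix.diagonal fun i : Fin m × Fin m => (((t : ℂ) + 2) ^ (w i))⁻¹) (by
      rw [Matrix.diagonal_mul_diagonal, ← Matrix.diagonal_one]
      congr 1; funext i; exact inv_mul_cancel₀ (zpow_ne_zero _ ht2))
  rw [Ne, ← map_zero (linSubst (Fin m × Fin m) ℂ (u : Matrix (Fin m × Fin m) (Fin m × Fin m) ℂ)), hu.eq_iff,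
    ← map_zero (linSubst (Fin m × Fin m) ℂ (Matrix.diagonal fun i : Fin m × Fin m => ((t : ℂ) + 2) ^ (w i))),
    hd.eq_iff, ← map_zero (linSubst (Fin m × Fin m) ℂ (g : Matrix (Fin m × Fin m) (Fin m × Fin m) ℂ)), hg.eq_iff]
  exact hdet

/-- Degree-`0` failure of the conclusion's clause (Li') when `C 1 ∈ J 0`: the only degree-`0`
annihilator of a non-zero polynomial is `0`. Shared by §2 and (via gen-1) §1. [folklore] -/
theorem no_lowerLimit_of_C_one {m : ℕ} (u g : Matrix.GeneralLinearGroup (Fin m × Fin m) ℂ)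
    (w : Fin m × Fin m → ℤ) (Ds : ℕ → MvPolynomial (Fin m × Fin m) ℂ)
    (hDs : ∀ t, (Ds t).IsHomogeneous 0 ∧ apolarAction (Ds t)
      (linSubst (Fin m × Fin m) ℂ (u : Matrix (Fin m × Fin m) (Fin m × Fin m) ℂ)
        (linSubst (Fin m × Fin m) ℂ (Matrix.diagonal fun i : Fin m × Fin m => ((t : ℂ) + 2) ^ (w i))
          (linSubst (Fin m × Fin m) ℂ (g : Matrix (Fin m × Fin m) (Fin m × Fin m) ℂ) (detPoly (Fin m) ℂ)))) = 0)
    (hlim : Tendsto (fun t => coeffVec (Ds t)) atTop (nhds (coeffVec (C 1 : MvPolynomial (Fin m × Fin m) ℂ)))) :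
    False := by
  have hDs0 : ∀ t, Ds t = 0 := by
    intro t
    by_contra hne
    obtain ⟨hhom, hact⟩ := hDs t
    have htd : (Ds t).totalDegree = 0 := hhom.totalDegree hne
    rw [MvPolynomial.totalDegree_eq_zero_iff_eq_C] at htd
    have hc0 : MvPolynomial.coeff 0 (Ds t) ≠ 0 := by
      intro h0; apply hne; rw [htd, h0, map_zero]
    rw [htd, apolarAction_C] at hact
    exact toricCurve_ne_zero u g w t ((smul_eq_zero.mp hact).resolve_left hc0)
  have hconst : (fun t => coeffVec (Ds t)) = fun _ => coeffVec (0 : MvPolynomial (Fin m × Fin m) ℂ) :=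
    funext fun t => by rw [hDs0]
  rw [hconst] at hlim
  have h01 : coeffVec (C 1 : MvPolynomial (Fin m × Fin m) ℂ) =
      coeffVec (0 : MvPolynomial (Fin m × Fin m) ℂ) := tendsto_nhds_unique hlim tendsto_const_nhds
  have := coeffVec_injective h01
  simp at this

/-- `ToricFixedPointsWithoutLowerLimit` is FALSE — witness `n = m = 3`, `P_t = det_3` (in the
orbit), `J_k = {D : D homogeneous of degree k}` (contains every subsequential limit of degree-`k`
annihilators, and is stable under every linear substitution); the conclusion's clause (Li') fails in
degree `0` at `D = C 1`.  Hence clause (Li) of the crux is load-bearing: it is the only hypothesis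
bounding `J_k` from above. [folklore] -/
theorem toricFixedPoints_false_without_lowerLimit : ¬ ToricFixedPointsWithoutLowerLimit := by
  intro h
  have h3 := @h 3 3 inferInstance le_rfl le_rfl
  dsimp only at h3
  refine absurd (h3 (fun _ => detPoly (Fin 3) ℂ) (fun k => {D | D.IsHomogeneous k})
    (fun _ => mem_glOrbit_self _) ?_ ?_) ?_
  · -- (Ls): coefficientwise limits of degree-k forms are degree-k forms
    intro k _hk D φ Ds _hφ hDs hlim d hd
    by_contra hne
    apply hd
    have hc : Filter.Tendsto (fun t => MvPolynomial.coeff d (Ds t)) Filter.atTop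
        (nhds (MvPolynomial.coeff d D)) := by
      have := tendsto_pi_nhds.mp hlim d
      simpa [coeffVec] using this
    have hdk : d.degree ≠ k := by
      intro hh; apply hne; rw [Finsupp.degree_eq_weight_one] at hh; exact hh
    have h0 : (fun t => MvPolynomial.coeff d (Ds t)) = fun _ => (0 : ℂ) :=
      funext fun t => (hDs t).1.coeff_eq_zero hdk
    rw [h0] at hc
    exact tendsto_nhds_unique hc tendsto_const_nhds
  · -- H₀-stability of J (any linear substitution preserves degree-k forms)
    intro A _h1 _h2 _h3 _h4 k _hk D hD
    exact linSubst_isHomogeneous _ hD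
  · -- the conclusion fails: degree 0, D = C 1
    rintro ⟨u, g, w, hW1', -⟩
    obtain ⟨Ds, hDs, hlim⟩ := hW1' 0 (Nat.zero_le _) (MvPolynomial.C 1) (MvPolynomial.isHomogeneous_C _ 1)
    exact no_lowerLimit_of_C_one u g w Ds hDs hlim

end Summit.ValiantsHypothesis.Cruxes.ToricFixedPoints.Negative
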